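import Summits.BirchSwinnertonDyer.BirchSwinnertonDyer.Theorems.TwoAdicConverseMultEisensteinPrint
import Summits.BirchSwinnertonDyer.BirchSwinnertonDyer.Theorems.ByReductionTypeAtTwoMultLowerHalfPrint
import Summits.BirchSwinnertonDyer.BirchSwinnertonDyer.Theorems.TwoAdicConverseMultCycDefs
import HarnessLib

/-!
# Route `TwoAdicConverse` (rung S3), multiplicative branch: the GLUE theorems BY NAME over the cyclotomic carrier
# leaves (`Theorems/TwoAdicConverseMultCycDefs.lean`) — for items 19219 / 19187 (S3) and 19923 (K4)

Cell `bsd-2adic`, seat `bsd-2adic-conv-2` GEN 4. THEOREMS ONLY (one-line compositions of p432672 / p432673 with the carrier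
constants); nothing asserted; no class booked; BSD is not proved by any of this. With these, a planner's `--resplit
MultiplicativeRankZeroTwoConverse --into MultCycPublishedInputsAtTwo MultGreenbergStevensAtTwo MultEisensteinHalfAtTwoIso` has its glue
BY NAME (`multiplicativeRankZeroTwoConverse_of_cycChildrenIso`), and the SAME member-wise leaf `MultEisensteinHalfAtTwo` serves K4ᵐ's
lower half 19923 (`multLowerHalfAtTwo_of_cycChildren`). PARTITION (D-0054): none — RANK axis (S3 mult) + X5@2 mult K4ᵐ lower half;
closes none. [cite: GreenbergLNM1716, §4 pp. 112–113 and Thm. 1.5 (p. 61)]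
-/

set_option linter.dupNamespace false
set_option autoImplicit false

noncomputable section

open WeierstrassCurve Literature.NumberTheory.EllipticCurves Literature.NumberTheory.EllipticCurves.ModularForms
  Literature.NumberTheory.EllipticCurves.Greenberg1999 Literature.NumberTheory.EllipticCurves.Rank1Residual
  Summit.BirchSwinnertonDyer.BirchSwinnertonDyer.Theses.TwoAdicConverse
  Summit.BirchSwinnertonDyer.BirchSwinnertonDyer.Theorems.TwoAdicMultCyc

namespace Summit.BirchSwinnertonDyer.BirchSwinnertonDyer.Theorems

/-- **GLUE BY NAME (isogeny-hedged crux): `MultCycPublishedInputsAtTwo → MultGreenbergStevensAtTwo → MultEisensteinHalfAtTwoIso →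
MultiplicativeRankZeroTwoConverse`** (item 19219) — p432672's `…_of_cotorsion_upToIsogeny` with the finite-`Sel` hypothesis
discarded. [cite: GreenbergLNM1716, §4 pp. 112–113 and Thm. 1.5 (p. 61)] -/
theorem multiplicativeRankZeroTwoConverse_of_cycChildrenIso
    (hP : Literature.NumberTheory.EllipticCurves.MultCycPublishedInputsAtTwo) (hGS : MultGreenbergStevensAtTwo)
    (hE : MultEisensteinHalfAtTwoIso) : MultiplicativeRankZeroTwoConverse :=
  multiplicativeRankZeroTwoConverse_of_multEisenstein_of_cotorsion_upToIsogeny hP.1 hP.2.1 hP.2.2.1 hP.2.2.2 hGS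
    (fun W _ _ hcm hmult _ => hE W hcm hmult)

/-- **GLUE BY NAME (member-wise crux): `MultCycPublishedInputsAtTwo → MultGreenbergStevensAtTwo → MultEisensteinHalfAtTwo →
MultiplicativeRankZeroTwoConverse`** (item 19219) — p432672's `…_of_cotorsion`. [cite: GreenbergLNM1716, §4 pp. 112–113 and Thm. 1.5 (p. 61)] -/
theorem multiplicativeRankZeroTwoConverse_of_cycChildren
    (hP : Literature.NumberTheory.EllipticCurves.MultCycPublishedInputsAtTwo) (hGS : MultGreenbergStevensAtTwo)
    (hE : MultEisensteinHalfAtTwo) : MultiplicativeRankZeroTwoConverse :=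
  multiplicativeRankZeroTwoConverse_of_multEisenstein_of_cotorsion hP.1 hP.2.1 hP.2.2.1 hP.2.2.2 hGS hE

/-- **The SERVED crux 19187 `MultTwoConverseOverKAtTwo` BY NAME from the route's PUB child `MultConversePublishedInputsAtTwo`
(19185) + the three cyclotomic leaves** (= LINE cycint's composition with named stubs). [cite: Kato2004Asterisque, Cor. 14.3 (p. 235)]
[cite: GreenbergLNM1716, §4 pp. 112–113 and Thm. 1.5 (p. 61)] -/
theorem multTwoConverseOverKAtTwo_of_cycChildrenIso (hPub : MultConversePublishedInputsAtTwo)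
    (hP : Literature.NumberTheory.EllipticCurves.MultCycPublishedInputsAtTwo) (hGS : MultGreenbergStevensAtTwo)
    (hE : MultEisensteinHalfAtTwoIso) : MultTwoConverseOverKAtTwo :=
  multTwoConverseOverKAtTwo_of_multiplicativeRankZeroTwoConverse hPub
    (multiplicativeRankZeroTwoConverse_of_cycChildrenIso hP hGS hE)

/-- **K4ᵐ: the lower half `MultLowerHalfAtTwo` (item 19923) BY NAME from the same PUB conjunction + GZK + the memo GS leaf + the
MEMBER-WISE Eisenstein leaf** (p432673's `multLowerHalfAtTwo_of_multEisenstein_of_cotorsion`; the analytic-rank-`0` restriction of the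
leaf is all that is used). One research object for S3ᵐ (member-wise form) and K4ᵐ-lower. [cite: GreenbergLNM1716, §4 pp. 112–113 and Thm. 1.5 (p. 61)]
[cite: Miller2011LMS, Def 1.1] -/
theorem multLowerHalfAtTwo_of_cycChildren
    (hP : Literature.NumberTheory.EllipticCurves.MultCycPublishedInputsAtTwo)
    (hGZK : rank_eq_analyticRank_of_analyticRank_le_one) (hGS : MultGreenbergStevensAtTwo)
    (hE : MultEisensteinHalfAtTwo) :
    Summit.BirchSwinnertonDyer.BirchSwinnertonDyer.Theses.ByReductionTypeAtTwo.MultLowerHalfAtTwo :=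
  multLowerHalfAtTwo_of_multEisenstein_of_cotorsion hP.1 hP.2.1 hP.2.2.1 hGZK hP.2.2.2 hGS
    (fun W _ _ hcm _ hmult => hE W hcm hmult)

end Summit.BirchSwinnertonDyer.BirchSwinnertonDyer.Theorems

end
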